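import Summits.AtomisticToContinuum.FouriersLaw.Theorems.BondHeatUncertaintyLightConeBondHeatGreenKuboDip

/-!
# `LightConeBondHeat` at the process level

Support file for item `stmt-AtomisticToContinuum-9123` (`BondHeatUncertainty.LightConeBondHeat`, (S_lc)).  The item is
stated for the KERNEL-LEVEL functional `V N b t = 2∫₀ᵗ (t−s) C N b s` (`C N b s = ∫ j_b · P_{s⁺} j_b dμ_T` behind a
`dite` on `b < N`).  By `pinnedChain_bondHeatVar_eq_integral_sq` (`…LightConeBondHeatGreenKuboDip`) this functional is
the second moment `E_{μ_T ⊗ W}[(∫₀ᵗ j_b(z_s) ds)²]` of the time-integrated bond current along the stationary constructed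
flow `z_s = Φ_s(x, B)`, `x ∼ μ_T`.  `lightConeBondHeat_iff_pathwise` records the resulting equivalent PROCESS-LEVEL form
of the item (bond as a `Fin N`, no `dite`), which is the form in which any martingale / energy-balance line at a bulk
bond would attack it.
-/

noncomputable section

open MeasureTheory ProbabilityTheory Filter Topology Set
open scoped NNReal ENNReal

namespace Summit.AtomisticToContinuum.FouriersLaw.Theorems.LightConeBondHeat

open Literature.MathematicalPhysics.KineticTheory.HeatConduction
open Literature.MathematicalPhysics.KineticTheory Literature.Probability.Process OscillatorChain
open Summit.AtomisticToContinuum.FouriersLaw.Theorems.SubdiffusiveBondHeat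
open Summit.AtomisticToContinuum.FouriersLaw.Theses.BondHeatUncertainty

/-- **(S_lc) at the process level.**  `LightConeBondHeat` is equivalent to: for all parameters `> 0` and `T > 0`
there are `A`, `a > 0`, `N₀` such that every chain of length `N ≥ N₀` has a bond `i` (`i + 1 < N`) with
`E_{μ_T ⊗ W}[(∫₀ᵗ j_i(z_s) ds)²] ≤ A√t` for all `1 ≤ t ≤ a·N`, where `z_s = Φ_s(x,B)` is the constructed flow of
the pinned chain at equal bath temperatures `T` started from `x ∼ μ_T` (the equilibrium variance of the heat
through bond `i` up to time `t`). [folklore] -/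
theorem lightConeBondHeat_iff_pathwise :
    LightConeBondHeat ↔
      ∀ ω₂ lam β γ : ℝ, 0 < ω₂ → 0 < lam → 0 < β → 0 < γ → ∀ T : ℝ, 0 < T →
        (let P := pinnedChain ω₂ lam β γ
         ∃ A a : ℝ, 0 < a ∧ ∃ N₀ : ℕ, ∀ N : ℕ, N₀ ≤ N → ∃ i : Fin N, i.val + 1 < N ∧
           ∀ t : ℝ, 1 ≤ t → t ≤ a * (N : ℝ) →
             ∫ p, (∫ s in (0 : ℝ)..t, P.bondCurrent N i (P.solMap N T T s p.1 (pairPath p.2))) ^ 2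
               ∂((P.gibbsMeasure N T).prod wienerPair) ≤ A * Real.sqrt t) := by
  constructor
  · intro hS ω₂ lam β γ hω hl hβ hγ T hT
    obtain ⟨A, a, ha, N₀, hN₀⟩ := hS ω₂ lam β γ hω hl hβ hγ T hT
    refine ⟨A, a, ha, N₀, fun N hN => ?_⟩
    obtain ⟨b, hb, hV⟩ := hN₀ N hN
    have hbN : b < N := by omega
    have hNpos : 0 < N := by omega
    refine ⟨⟨b, hbN⟩, hb, fun t h1 ht => ?_⟩
    have h0 : (0:ℝ) ≤ t := by linarith
    rw [← pinnedChain_bondHeatVar_eq_integral_sq hω hl.le hβ hγ hNpos hT ⟨b, hbN⟩ h0]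
    simpa [dif_pos hbN] using hV t h1 ht
  · intro hP ω₂ lam β γ hω hl hβ hγ T hT
    obtain ⟨A, a, ha, N₀, hN₀⟩ := hP ω₂ lam β γ hω hl hβ hγ T hT
    refine ⟨A, a, ha, N₀, fun N hN => ?_⟩
    obtain ⟨i, hi, hV⟩ := hN₀ N hN
    have hNpos : 0 < N := by omega
    refine ⟨i.val, hi, fun t h1 ht => ?_⟩
    have h0 : (0:ℝ) ≤ t := by linarith
    have key := hV t h1 ht
    rw [← pinnedChain_bondHeatVar_eq_integral_sq hω hl.le hβ hγ hNpos hT i h0] at key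
    simpa [dif_pos i.isLt] using key

end Summit.AtomisticToContinuum.FouriersLaw.Theorems.LightConeBondHeat

end
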